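import Summits.FinalStateConjecture.FinalStateConjecture.Theorems.PhaseMixingCaptureCaptureSufficesDecompositionDilation
import Literature.Geometry.Lorentzian.CauchyDevelopmentConstSmul
import Literature.Geometry.Lorentzian.NullInfinityConstSmul

/-!
# Stub `stub_scaleCovariance` of the line `old-light-forces-soft-burial`
# (item `CaptureSuffices`, stmt-FinalStateConjecture-9953, route `PhaseMixingCapture`): SCALE COVARIANCE
# of the settling clauses

If `D' = (λ² h, λ k)` is the `λ`-dilate of the vacuum datum `D = (h, k)` (`λ > 0`) and every maximal
vacuum Cauchy development of `D'` has complete future null infinity (sojourn form) and a sub-extremal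
exhaustive `C²` final state decomposition of `O = J⁺(ι X) ∩ I⁻(charted)`, then so has every maximal
vacuum Cauchy development `𝒟 = (M, g, τ, ι, ν)` of `D`. Proof: the dilate `(M, λ² g, τ, ι, λ⁻¹ν)` of
`𝒟` (`VacuumCauchyDevelopment.constSmul`) is a MAXIMAL vacuum Cauchy development of `D'`
(`isMaximal_constSmul`); the hypothesis applied to it gives complete `𝓘⁺` of `(M, λ² g)`, which
descends to `g` (`LorentzianMetric.hasCompleteFutureNullInfinity_of_constSmul`: rays reparametrise,
sojourn times scale), and a decomposition of `(M, λ² g)`, which is transported along the dilation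
`y ↦ λ y` of the chart domains (`exists_finalStateDecomposition_of_constSmul` of the companion module
`…Theorems.PhaseMixingCaptureCaptureSufficesDecompositionDilation`); `exteriorOf` is conformally
invariant. No definitions, no named facts.

References: Bartnik–Isenberg, *The constraint equations* (2004), §2 (scaling of the constraints);
Christodoulou, CQG 16 (1999) A23, pp. A26–A27 (sojourn form of complete `𝓘⁺`); O'Neill 1983, Ch. 14.
-/

-- the doubled `FinalStateConjecture.FinalStateConjecture` path component trips dupNamespace
set_option linter.dupNamespace false

noncomputable section

open Set Filter Topology TopologicalSpace
open scoped Manifold ContDiff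

namespace Summit.FinalStateConjecture.FinalStateConjecture.Theorems.CaptureSuffices.ScaleCovariance

open Literature.Geometry.Lorentzian

/-! ## §5 Vacuum Cauchy developments and the registered stub -/

section Development

variable {X : Type} [TopologicalSpace X] [ChartedSpace E3 X] [IsManifold (𝓡 3) ∞ X]
  [ConnectedSpace X] {D D' : InitialDataSet (𝓡 3) X} (𝒟 : VacuumCauchyDevelopment D) {c : ℝ}
  (hc : 0 < c)
  (hh : ∀ (x : X) (v w : TangentSpace (𝓡 3) x), D'.h.inner x v w = c ^ 2 * D.h.inner x v w)
  (hk : ∀ (x : X) (v w : TangentSpace (𝓡 3) x), D'.k x v w = c * D.k x v w)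

/-- **Complete `𝓘⁺` descends from the dilated development**: if the dilate `(M, c² g, τ, ι, c⁻¹ν)`
of `𝒟` has complete future null infinity (sojourn form, `HasCompleteNullInfinity`), so has `𝒟`
(`LorentzianMetric.hasCompleteFutureNullInfinity_of_constSmul`; the Levi-Civita connection of `c² g`
is that of `g`). Christodoulou, CQG 16 (1999), pp. A26–A27. [folklore] -/
theorem hasCompleteNullInfinity_of_constSmul
    (h : HasCompleteNullInfinity (𝒟.constSmul c hc D' hh hk).toCauchyDevelopment) :
    HasCompleteNullInfinity 𝒟.toCauchyDevelopment := by
  unfold HasCompleteNullInfinity at h ⊢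
  intro inst
  haveI i2 : (𝒟.metric.constSmul (c ^ 2) (pow_pos hc 2)).HasLeviCivita :=
    PseudoRiemannianMetric.HasLeviCivita.constSmul (g := 𝒟.metric.toPseudoRiemannianMetric)
      (c ^ 2) (pow_pos hc 2).ne'
  exact LorentzianMetric.hasCompleteFutureNullInfinity_of_constSmul 𝒟.metric 𝒟.timeOrientation
    𝒟.embed 𝒟.normal hc (@h i2)

/-- **The exterior region is unchanged by the dilation**: `J⁺(ι X) ∩ I⁻(U)` is the same set for
`(M, g, τ)` and `(M, c² g, τ)` (conformal invariance of `J⁺`, `I⁻`). O'Neill 1983, Ch. 14. [folklore] -/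
theorem exteriorOf_constSmul (U : Set 𝒟.carrier) :
    exteriorOf (𝒟.constSmul c hc D' hh hk).toCauchyDevelopment U =
      exteriorOf 𝒟.toCauchyDevelopment U := by
  unfold exteriorOf
  exact congrArg₂ (· ∩ ·)
    (LorentzianMetric.causalFuture_constSmul 𝒟.metric 𝒟.timeOrientation (pow_pos hc 2) _)
    (LorentzianMetric.chronologicalPast_constSmul 𝒟.metric 𝒟.timeOrientation (pow_pos hc 2) _)

/-- **The settling clauses descend from the dilate** (one development): if the dilate of the maximal
vacuum Cauchy development `𝒟` of `D` satisfies the `∀`-MGHD clauses of the summit conclusion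
(complete `𝓘⁺`; a sub-extremal exhaustive `C²` decomposition of `O = exteriorOf … charted`), then so
does `𝒟`. [folklore] -/
theorem settles_of_constSmul
    (h : HasCompleteNullInfinity (𝒟.constSmul c hc D' hh hk).toCauchyDevelopment ∧
      ∃ (O : Set (𝒟.constSmul c hc D' hh hk).carrier)
        (dec : FinalStateDecomposition (𝒟.constSmul c hc D' hh hk).toSpacetime O 2),
        (∀ i, Kerr.IsSubextremal (dec.mass i) (dec.spin i)) ∧
          O = exteriorOf (𝒟.constSmul c hc D' hh hk).toCauchyDevelopment dec.charted ∧
            HasExhaustiveCharts dec) :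
    HasCompleteNullInfinity 𝒟.toCauchyDevelopment ∧
      ∃ (O : Set 𝒟.carrier) (dec : FinalStateDecomposition 𝒟.toSpacetime O 2),
        (∀ i, Kerr.IsSubextremal (dec.mass i) (dec.spin i)) ∧
          O = exteriorOf 𝒟.toCauchyDevelopment dec.charted ∧ HasExhaustiveCharts dec := by
  obtain ⟨hnull, O, dec', hsub', hO', hex'⟩ := h
  refine ⟨hasCompleteNullInfinity_of_constSmul 𝒟 hc hh hk hnull, ?_⟩
  obtain ⟨dec, hchart, hsub, hex⟩ :=
    exists_finalStateDecomposition_of_constSmul (𝓢 := 𝒟.toSpacetime) hc dec'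
  refine ⟨O, dec, hsub hsub', ?_, hex hex'⟩
  rw [hchart, ← exteriorOf_constSmul 𝒟 hc hh hk]
  exact hO'

end Development

/-- **Stub 5 of the line `old-light-forces-soft-burial` — SCALE COVARIANCE of the settling clauses**
(registered on item stmt-FinalStateConjecture-9953 as `stub_scaleCovariance`, verbatim signature). If
`D' = (λ² h, λ k)` is the `λ`-dilate of `D = (h, k)` (`λ > 0`) and every maximal vacuum Cauchy
development of `D'` has complete `𝓘⁺` and a sub-extremal exhaustive `C²` final state decomposition of
`O = J⁺(ι X) ∩ I⁻(charted)`, then so has every maximal vacuum Cauchy development `𝒟` of `D`: the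
dilate `(M, λ² g, τ, ι, λ⁻¹ ν)` of `𝒟` is a MAXIMAL vacuum Cauchy development of `D'`
(`VacuumCauchyDevelopment.isMaximal_constSmul`), the hypothesis applies to it, and its conclusions
descend along the dilation `y ↦ λ y` of the chart domains (`settles_of_constSmul`). Bartnik–Isenberg
2004, §2 (scaling of the constraints); Kerr–Schild 1965, §2. [folklore] -/
theorem stub_scaleCovariance :
    ∀ (X : Type) [TopologicalSpace X] [ChartedSpace E3 X] [IsManifold (𝓡 3) ∞ X] [T2Space X]
      [SecondCountableTopology X] [ConnectedSpace X] (D D' : InitialDataSet (𝓡 3) X) (lam : ℝ),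
      0 < lam →
        ((∀ (x : X) (v w : TangentSpace (𝓡 3) x), D'.h.inner x v w = lam ^ 2 * D.h.inner x v w) ∧
          ∀ (x : X) (v w : TangentSpace (𝓡 3) x), D'.k x v w = lam * D.k x v w) →
        (∀ 𝒟 : VacuumCauchyDevelopment D', 𝒟.IsMaximal →
          Summit.FinalStateConjecture.HasCompleteNullInfinity 𝒟.toCauchyDevelopment ∧
            ∃ (O : Set 𝒟.carrier) (dec : FinalStateDecomposition 𝒟.toSpacetime O 2),
              (∀ i, Kerr.IsSubextremal (dec.mass i) (dec.spin i)) ∧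
                O = Summit.FinalStateConjecture.exteriorOf 𝒟.toCauchyDevelopment dec.charted ∧
                  Summit.FinalStateConjecture.HasExhaustiveCharts dec) →
        (∀ 𝒟 : VacuumCauchyDevelopment D, 𝒟.IsMaximal →
          Summit.FinalStateConjecture.HasCompleteNullInfinity 𝒟.toCauchyDevelopment ∧
            ∃ (O : Set 𝒟.carrier) (dec : FinalStateDecomposition 𝒟.toSpacetime O 2),
              (∀ i, Kerr.IsSubextremal (dec.mass i) (dec.spin i)) ∧
                O = Summit.FinalStateConjecture.exteriorOf 𝒟.toCauchyDevelopment dec.charted ∧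
                  Summit.FinalStateConjecture.HasExhaustiveCharts dec) := by
  intro X _ _ _ _ _ _ D D' lam hlam hdil hD' 𝒟 hmax
  obtain ⟨hh, hk⟩ := hdil
  exact settles_of_constSmul 𝒟 hlam hh hk
    (hD' (𝒟.constSmul lam hlam D' hh hk) (𝒟.isMaximal_constSmul hlam hh hk hmax))

end Summit.FinalStateConjecture.FinalStateConjecture.Theorems.CaptureSuffices.ScaleCovariance

end
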